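import Summits.QuantumFields.BalabanUV.Beta.FP.PerfectColumnEngineLetters

/-!
# `Beta/FP/MixLoopInstanceBlockFamily` — road «FP» (binder row D1), row **RHOA-6e (INST-MIX)** «THE MIX-2 ENGINE AT THE ROOTED BLOCK FAMILY AND THE
# LATTICE COLUMNS»: RHOA-6c′'s mass-currency (MIX-2) engine `MixLoopPowerCountingMass.coarse_mix2_secondMoment_le` INSTANTIATED with the first-jet
# majorant kernel of RHOA-6b′'s rooted block families (`AveragingJetLettersRooted.ker₁ (blkW N p) (blkFld N μ u) (blkBg N μ u rad id)`), the windowed mass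
# letter (M) of `WindowedBlockMass.blk_windowedMass_le_half`, and the perfect minimiser columns `N⁴ • colOf (KPerf …)` in the letter shapes (I)(J)(J′) of
# `PerfectColumnEngineLetters.engineLetters_perfCol` — every power of `N = Lc^m` DISPLAYED ([folklore] index plumbing on `ℤ⁴`; no road object identified)

HONEST FRAMING (cell `pub-balaban`, β sub-cell, verbatim): discharging `BetaPertH` makes Bałaban's UV stability UNCONDITIONAL — a real constructive-QFT
result; it is NOT the continuum limit and NOT the Clay problem.  THIS MODULE is [folklore] finite-sum plumbing (support of a kernel ⟹ filtered windows;
`|N⁴•w| = N⁴|w|`) composed BY NAME with four ACCEPTED tree theorems of this road: `MixLoopPowerCountingMass.coarse_mix2_secondMoment_le` (owner d1-p3-g7,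
RHOA-6c′), `AveragingJetLettersRooted.blk_support`∕`sum_ker₁_le_mass₁` and `WindowedBlockMass.blk_windowedMass_le_half` (t4-ne7b-formalise-leaf-02-g22,
RHOA-6b′), `PerfectColumnEngineLetters.engineLetters_perfCol` (owner d1-p3-g8, RHOA-6e K-side).  It asserts nothing about Bałaban's objects, cites nothing,
mints no `Prop` fact, has no `def`, 0 sorry.  NOT `Mix_n = O(1)` (the instance number `Σ_σ p σ ≲ N` is KER-γ (γ)'s; the four-direction sum, MIX-1∕3∕4 and the
(rem)-piece packaging for `RemainderLedger.hbook_perfect_of_pieces` are the owner's (LEDGER)), NOT hbook, NOT D1, NOT BetaPertH, NOT continuum, NOT Clay.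
HONEST DEPENDENCY: continuum YM on T⁴ ⇐ BetaPertH ∧ nine spine estimates (0/9 proved); BetaPertH ⇐ (D1) ∧ (D4) ∧ CAP+tail; G-an2-4 gates asym, D1 and NE2/3/4.

ABSOLUTE RULE (cell charter, verbatim): «No internally-minted statement may enter as a cited fact. Every hypothesis is either kernel-proved in this package or a
verbatim quotation of a PUBLISHED theorem with page reference. The manuscript(s) under audit are NOT citable for their own disputed steps — they are the thing under
adjudication; programme-internal (2001/route/tribunal) claims are never citable.»

THE ROW (road-FP OWNER b2b-balaban-beta-d1-p3-g8, ROW RHOA-6e SPLIT, journal 2026-08-21T03:32:50Z, verbatim up to notation): «instantiate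
`coarse_mix2_secondMoment_le` with — per coarse direction `μ` — `qd u b c := ker₁ (blkW N p) (blkFld N μ u) (blkBg N μ u rad strB) b c`, `U b := {u : mass₁^{(u)} b ≠ 0}`
(finite, inside `‖b − N•u‖∞ ≤ R₀N` by `blk_mass₁_local`), `W :=` the box of radius `(R₀+2)·N` (field legs within `2N` of the anchor), `I := J :=` the lattice columns
`J_m κ l (N•v − b)` ×N⁴ (letters (I)(J): `C·N⁻¹·e^{−((κ₀∕4)∕N)‖b−N•v‖∞}`, (J′): `C·N⁻¹·A(κ₀)`), (M) := `blk_windowedMass_le_half` ⟹ `mix2_rem_blockFamily`: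
`∀ m ≥ 1, ∀ V v₀, Σ_{v∈V}‖v−v₀‖∞²·|T₂^{(μ)}(v₀,v)| ≤ 3·(C·N⁻¹·e^{2(R₀+2)κ₀∕4})²·(C·N⁻¹)·(C·N⁻¹·A(κ₀))·(1+20∕(κ₀∕4)²)·A_M²` with EVERY power of `N` displayed —
i.e. `≍ N⁻⁴·((ℓ₀+N)·Σp)²`.»

CURRENCY (forced by the engine, which indexes background insertions by fine POINTS `b ∈ ℤ⁴`): background labels ARE fine points (`B = Pt`, `pos = id`,
`strB = id`); the radial path rules `rad σ u x′ : List Pt` stay FREE with their two displayed letters (length `≤ ℓ₀`, radius `‖ℓ − N•u‖∞ ≤ R₀·N`, `2 ≤ R₀`), the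
probabilities `p σ ≥ 0` stay FREE (NOT pinned to `Σp = 1`); a labelled family with `pos ∘ strB = id` maps to this one under `List.map pos` (not needed, not typed).

CONTENT.  §1 [folklore] support plumbing: `supNorm_pt_le_two_mul` and the engine's two radius letters READ OFF the kernel's support (`blk_support` BY NAME)
 — **`blk_ker₁_ins_local`** ((U): `ker₁^{(u)} b c ≠ 0 ⟹ ‖b − N•u‖∞ ≤ R₀N`), **`blk_ker₁_fld_local`** ((W): `⟹ ‖c − b‖∞ ≤ (R₀+2)N`).
§2 **`windowedMass_blk_le`** = the engine's (M)-letter for `M(b) = Σ_{u∈U b} Σ_{w∈W} |ker₁^{(u)} b (b+w)|`, ANY `U : Pt → Finset Pt`, ANY finite `W`, bound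
`A_M := ((ℓ₀+N)·Σp)·e^{δR₀∕2}·(e^{δ∕2}(1+480e^{δ∕4}(4∕δ)⁴))` (`Σ_w ker₁ ≤ mass₁`, `U b ⊆ S.biUnion U`, `blk_windowedMass_le_half` BY NAME);
**`coarse_mix2_secondMoment_blk`** = the engine at the block family with ABSTRACT legs `I`, `J` under (I)(J)(J′), radius letters (U)(W) displayed (`R := R₀ + 2`).
§3 `loopKernel_eq_filter` + **`coarse_mix2_secondMoment_blk_free`**: the same bound with the kernel summed over ARBITRARY finite coarse and offset windows
`Y`, `W` — NO radius hypothesis (far terms vanish by §1).  §4 `latticeColumn_engineLetters` (`engineLetters_perfCol` ×`N⁴`: (I)(J) `C·N⁻¹·e^{−((κ₀∕4)∕N)‖c − N•u‖∞}`,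
(J′) `C·N⁻¹·A(κ₀)`, ONE `(κ₀, C)` for all `m ≥ 1`, all `κ l`) and the END **`mix2_rem_blockFamily`** = the owner's display, `∃ κ₀ C` BEFORE `∀ m ≥ 1` and before
the block-family data (which may depend on `m`).
NOT TYPED HERE: the identification of `T₂^{(μ)}` with the road's (MIX-2) term (KER-γ (α)), the instance number `Σ_σ p σ` (KER-γ (γ)), the comb ∕ S_D radial
rules, the four-direction sum and the (rem) packaging (LEDGER), MIX-1∕3∕4.  Provenance: cross-cell idle-seat kernel duty NE7b → β∕D1, unit
`b2b-balaban-t4-ne7b-formalise-leaf-02` gen 23 (prover-…-leaf-02-g23-0), 2026-08-21, first refusal (INST-MIX) exercised (journal CLAIM l.26511); «not in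
print; our bookkeeping»; no existing file touched.
-/

noncomputable section

namespace Summit.QuantumFields.BalabanUV.Beta.FP.MixLoopInstanceBlockFamily

open Finset Real
open scoped BigOperators
open Literature.MathematicalPhysics.QuantumFieldTheory.Balaban1983to89
open Literature.MathematicalPhysics.QuantumFieldTheory.Balaban1983to89.Beta
open DyadicShell (Pt supNorm supNorm_le_iff)
open BlockLegs (supNorm_sub_le_real)
open AxialBlockWeights (idx pt mem_fineBlock pt_apply)
open Summit.QuantumFields.BalabanUV.Beta.GAN24.CombesThomas (sfStep smStep)
open Summit.QuantumFields.BalabanUV.Beta.FP.PerfectObjectsT (KPerf)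
open Summit.QuantumFields.BalabanUV.Beta.FP.TransportInfinityM (colOf)
open Summit.QuantumFields.BalabanUV.Beta.FP.AveragingJetLetters (mem_idx_iff)
open Summit.QuantumFields.BalabanUV.Beta.FP.AveragingJetLettersRooted (ker₁ mass₁ blkW blkFld blkBg blkW_nonneg ker₁_nonneg mass₁_nonneg
  sum_ker₁_le_mass₁ blk_support)
open Summit.QuantumFields.BalabanUV.Beta.FP.WindowedBlockMass (blk_windowedMass_le_half)
open Summit.QuantumFields.BalabanUV.Beta.FP.MixLoopPowerCountingMass (coarse_mix2_secondMoment_le)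
open Summit.QuantumFields.BalabanUV.Beta.FP.PerfectColumnEngineLetters (engineLetters_perfCol)

/-! ## §1 Support plumbing -/

/-- [folklore] the bonds of the straight segment of a block sit within `2N` of the block anchor: `‖pt μ q‖∞ ≤ 2N` for `q ∈ idx N`. -/
theorem supNorm_pt_le_two_mul {N : ℕ} (μ : Fin 4) {q : Pt × ℕ} (hq : q ∈ idx N) : supNorm (pt μ q) ≤ 2 * N := by
  have hq' := mem_idx_iff.mp hq
  have hx := mem_fineBlock.mp hq'.1
  refine supNorm_le_iff.mpr fun i => ?_
  have h1 := hx i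
  have hs : q.2 < N := hq'.2
  rw [pt_apply]
  split_ifs <;> omega

section Block

variable {σ : Type*} [Fintype σ] {N : ℕ} {μ : Fin 4} {p : σ → ℝ} {rad : σ → Pt → Pt → List Pt} {ℓ₀ R₀ : ℕ}

/-- **(U) READ OFF THE SUPPORT** ([folklore]): with point labels (`strB = id`) and the radial radius letter `‖ℓ − N•u‖∞ ≤ R₀·N` (`2 ≤ R₀`), a nonzero
entry `ker₁^{(u)} b c` of the block-`u` kernel has its background insertion `b` within `R₀·N` of the anchor `N•u`. -/
theorem blk_ker₁_ins_local (hR₀ : 2 ≤ R₀)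
    (hradR : ∀ (s : σ) (u : Pt) (q : ↥(idx N)) (ℓ : Pt), ℓ ∈ rad s u q.1.1 → supNorm (ℓ - (N : ℤ) • u) ≤ R₀ * N)
    {u b c : Pt} (h : ker₁ (blkW N p) (blkFld N μ u) (blkBg N μ u rad id) b c ≠ 0) :
    supNorm (b - (N : ℤ) • u) ≤ R₀ * N := by
  obtain ⟨q, hq, s, _, hb⟩ := blk_support h
  rcases hb with hb | ⟨j, hj, hbj⟩
  · exact hradR s u ⟨q, hq⟩ b hb
  · have hqN := (mem_idx_iff.mp hq).2
    have hqj : (q.1, j) ∈ idx N := mem_idx_iff.mpr ⟨(mem_idx_iff.mp hq).1, lt_trans hj hqN⟩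
    have hz : b - (N : ℤ) • u = pt μ (q.1, j) := by
      rw [hbj, id, ← natCast_zsmul u N]; abel
    rw [hz]
    calc supNorm (pt μ (q.1, j)) ≤ 2 * N := supNorm_pt_le_two_mul μ hqj
      _ ≤ R₀ * N := Nat.mul_le_mul_right N hR₀

/-- **(W) READ OFF THE SUPPORT** ([folklore]): a nonzero entry `ker₁^{(u)} b c` has its field leg `c` within `(R₀+2)·N` of the background insertion `b`
(`c = N•u + pt μ q` on the straight segment, `‖pt μ q‖∞ ≤ 2N`, and (U)). -/
theorem blk_ker₁_fld_local (hR₀ : 2 ≤ R₀)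
    (hradR : ∀ (s : σ) (u : Pt) (q : ↥(idx N)) (ℓ : Pt), ℓ ∈ rad s u q.1.1 → supNorm (ℓ - (N : ℤ) • u) ≤ R₀ * N)
    {u b c : Pt} (h : ker₁ (blkW N p) (blkFld N μ u) (blkBg N μ u rad id) b c ≠ 0) :
    supNorm (c - b) ≤ (R₀ + 2) * N := by
  have hb := blk_ker₁_ins_local (μ := μ) (p := p) hR₀ hradR h
  obtain ⟨q, hq, s, hc, _⟩ := blk_support h
  have hcz : c - (N : ℤ) • u = pt μ q := by
    rw [← hc, ← natCast_zsmul u N]; abel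
  have h1 : supNorm (c - (N : ℤ) • u) ≤ 2 * N := by rw [hcz]; exact supNorm_pt_le_two_mul μ hq
  have e : c - b = (c - (N : ℤ) • u) - (b - (N : ℤ) • u) := by abel
  have hreal : (supNorm (c - b) : ℝ) ≤ supNorm (c - (N : ℤ) • u) + supNorm (b - (N : ℤ) • u) := by
    rw [e]; exact supNorm_sub_le_real _ _
  have h2 : (supNorm (c - b) : ℝ) ≤ (2 * N : ℕ) + (R₀ * N : ℕ) := by
    have h1' : (supNorm (c - (N : ℤ) • u) : ℝ) ≤ (2 * N : ℕ) := by exact_mod_cast h1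
    have hb' : (supNorm (b - (N : ℤ) • u) : ℝ) ≤ (R₀ * N : ℕ) := by exact_mod_cast hb
    linarith
  have h3 : supNorm (c - b) ≤ 2 * N + R₀ * N := by exact_mod_cast h2
  calc supNorm (c - b) ≤ 2 * N + R₀ * N := h3
    _ = (R₀ + 2) * N := by ring

/-! ## §2 The engine's (M)-letter and the engine at the block family, abstract legs -/

/-- **(M) FOR THE ENGINE's MASS `M(b) = Σ_{u∈U b} Σ_{w∈W} |ker₁^{(u)} b (b+w)|`** ([folklore]; ANY coarse windows `U b`, ANY finite offset window `W`, every
fine centre `c`): `Σ_{b∈S} e^{−(δ∕(2N))‖b−c‖∞}·M(b) ≤ ((ℓ₀+N)·Σ_σ p σ)·e^{δR₀∕2}·(e^{δ∕2}(1+480e^{δ∕4}(4∕δ)⁴))` — `Σ_{w∈W} ker₁^{(u)} b (b+w) ≤ mass₁^{(u)} b`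
(`sum_ker₁_le_mass₁` on the translated window), `U b ⊆ S.biUnion U`, then `WindowedBlockMass.blk_windowedMass_le_half` BY NAME at `pos = id`, `strB = id`. -/
theorem windowedMass_blk_le {δ : ℝ} (hδ : 0 < δ) (hN : 1 ≤ N) (μ : Fin 4) (hp : ∀ s, 0 ≤ p s)
    (hrad : ∀ s u x', (rad s u x').length ≤ ℓ₀) (hR₀ : 2 ≤ R₀)
    (hradR : ∀ (s : σ) (u : Pt) (q : ↥(idx N)) (ℓ : Pt), ℓ ∈ rad s u q.1.1 → supNorm (ℓ - (N : ℤ) • u) ≤ R₀ * N)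
    (U : Pt → Finset Pt) (W S : Finset Pt) (c : Pt) :
    ∑ b ∈ S, Real.exp (-(δ / (2 * N)) * (supNorm (b - c) : ℝ)) *
        (∑ u ∈ U b, ∑ w ∈ W, |ker₁ (blkW N p) (blkFld N μ u) (blkBg N μ u rad id) b (b + w)|)
      ≤ (((ℓ₀ + N : ℕ) : ℝ) * ∑ s, p s) * Real.exp (δ * R₀ / 2) *
          (Real.exp (δ / 2) * (1 + 480 * Real.exp (δ / 4) * (4 / δ) ^ 4)) := by
  classical
  set Y : Finset Pt := S.biUnion U with hY
  have hω := blkW_nonneg N hp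
  -- the inner mass of the engine is at most the windowed family mass over `Y`
  have hinner : ∀ b ∈ S, ∑ u ∈ U b, ∑ w ∈ W, |ker₁ (blkW N p) (blkFld N μ u) (blkBg N μ u rad id) b (b + w)|
      ≤ ∑ u ∈ Y, mass₁ (blkW N p) (blkBg N μ u rad id) b := by
    intro b hb
    have hUb : U b ⊆ Y := by rw [hY]; exact Finset.subset_biUnion_of_mem U hb
    have hw : ∀ u, ∑ w ∈ W, |ker₁ (blkW N p) (blkFld N μ u) (blkBg N μ u rad id) b (b + w)|
        ≤ mass₁ (blkW N p) (blkBg N μ u rad id) b := by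
      intro u
      have habs : ∀ w, |ker₁ (blkW N p) (blkFld N μ u) (blkBg N μ u rad id) b (b + w)|
          = ker₁ (blkW N p) (blkFld N μ u) (blkBg N μ u rad id) b (b + w) := fun w => abs_of_nonneg (ker₁_nonneg hω _ _)
      simp only [habs]
      rw [← Finset.sum_image (s := W) (g := fun w => b + w) (f := fun c' => ker₁ (blkW N p) (blkFld N μ u) (blkBg N μ u rad id) b c')
        (fun x _ y _ h => add_left_cancel h)]
      exact sum_ker₁_le_mass₁ hω _ b
    calc ∑ u ∈ U b, ∑ w ∈ W, |ker₁ (blkW N p) (blkFld N μ u) (blkBg N μ u rad id) b (b + w)|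
        ≤ ∑ u ∈ U b, mass₁ (blkW N p) (blkBg N μ u rad id) b := Finset.sum_le_sum fun u _ => hw u
      _ ≤ ∑ u ∈ Y, mass₁ (blkW N p) (blkBg N μ u rad id) b :=
          Finset.sum_le_sum_of_subset_of_nonneg hUb fun u _ _ => mass₁_nonneg hω b
  have hR₀' : (2 : ℝ) ≤ (R₀ : ℝ) := by exact_mod_cast hR₀
  have hradR' : ∀ (s : σ) (u : Pt) (q : ↥(idx N)) (ℓ : Pt), ℓ ∈ rad s u q.1.1 →
      (supNorm (id ℓ - (N : ℤ) • u) : ℝ) ≤ (R₀ : ℝ) * N := by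
    intro s u q ℓ h
    have h' := hradR s u q ℓ h
    rw [id]
    exact_mod_cast h'
  have hM := blk_windowedMass_le_half (B := Pt) (strB := id) hδ hN μ hp hrad id hR₀' (fun _ => rfl) hradR' S Y c
  calc ∑ b ∈ S, Real.exp (-(δ / (2 * N)) * (supNorm (b - c) : ℝ)) *
          (∑ u ∈ U b, ∑ w ∈ W, |ker₁ (blkW N p) (blkFld N μ u) (blkBg N μ u rad id) b (b + w)|)
      ≤ ∑ b ∈ S, Real.exp (-(δ / (2 * N)) * (supNorm (b - c) : ℝ)) * ∑ u ∈ Y, mass₁ (blkW N p) (blkBg N μ u rad id) b :=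
        Finset.sum_le_sum fun b hb => mul_le_mul_of_nonneg_left (hinner b hb) (Real.exp_pos _).le
    _ ≤ _ := by simpa only [id] using hM

/-- **THE (MIX-2) ENGINE AT THE ROOTED BLOCK FAMILY, ABSTRACT LEGS** ([folklore] plumbing; the engine `coarse_mix2_secondMoment_le` BY NAME with
`qd u b c := ker₁ (blkW N p) (blkFld N μ u) (blkBg N μ u rad id) b c`, radius multiplier `R := R₀ + 2`, (M) := `windowedMass_blk_le`): under the radius letters
(U) `u ∈ U b ⟹ ‖b − N•u‖∞ ≤ (R₀+2)N`, (W) `w ∈ W ⟹ ‖w‖∞ ≤ (R₀+2)N` and the leg letters (I) `|I c u| ≤ C_I·e^{−(δ∕N)‖c − N•u‖∞}`, (J) `|J b v₀| ≤ C_J·e^{−(δ∕N)‖b − N•v₀‖∞}`,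
(J′) `Σ_{v∈V}(1 + (‖b′ − N•v‖∞∕N)²)|J b′ v| ≤ C_J′`, for all finite `S`, `V` and every `v₀`:
`Σ_{v∈V}‖v−v₀‖∞²·|Σ_{b,b′∈S} J b v₀·J b′ v·k₂(b,b′)| ≤ 3·(C_I·e^{2(R₀+2)δ})²·C_J·C_J′·(1+20∕δ²)·A_M²`, `A_M = ((ℓ₀+N)·Σp)·e^{δR₀∕2}·(e^{δ∕2}(1+480e^{δ∕4}(4∕δ)⁴))`. -/
theorem coarse_mix2_secondMoment_blk {δ : ℝ} (hδ : 0 < δ) (hN : 1 ≤ N) (μ : Fin 4) (hp : ∀ s, 0 ≤ p s)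
    (hrad : ∀ s u x', (rad s u x').length ≤ ℓ₀) (hR₀ : 2 ≤ R₀)
    (hradR : ∀ (s : σ) (u : Pt) (q : ↥(idx N)) (ℓ : Pt), ℓ ∈ rad s u q.1.1 → supNorm (ℓ - (N : ℤ) • u) ≤ R₀ * N)
    {U : Pt → Finset Pt} (hU : ∀ b, ∀ u ∈ U b, supNorm (b - (N : ℤ) • u) ≤ (R₀ + 2) * N)
    {W : Finset Pt} (hW : ∀ w ∈ W, supNorm w ≤ (R₀ + 2) * N)
    {I J : Pt → Pt → ℝ} {C_I C_J C_J' : ℝ}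
    (hI : ∀ c u, |I c u| ≤ C_I * Real.exp (-(δ / N) * (supNorm (c - (N : ℤ) • u) : ℝ)))
    (S V : Finset Pt) (v₀ : Pt)
    (hJ : ∀ b, |J b v₀| ≤ C_J * Real.exp (-(δ / N) * (supNorm (b - (N : ℤ) • v₀) : ℝ)))
    (hJ' : ∀ b', ∑ v ∈ V, (1 + ((supNorm (b' - (N : ℤ) • v) : ℝ) / N) ^ 2) * |J b' v| ≤ C_J') :
    ∑ v ∈ V, (supNorm (v - v₀) : ℝ) ^ 2 *
        |∑ b ∈ S, ∑ b' ∈ S, J b v₀ * J b' v *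
          (∑ u ∈ U b, ∑ u' ∈ U b',
            (∑ w ∈ W, ker₁ (blkW N p) (blkFld N μ u) (blkBg N μ u rad id) b (b + w) * I (b + w) u') *
            (∑ w' ∈ W, ker₁ (blkW N p) (blkFld N μ u') (blkBg N μ u' rad id) b' (b' + w') * I (b' + w') u))|
      ≤ 3 * (C_I * Real.exp (2 * ((R₀ : ℝ) + 2) * δ)) ^ 2 * C_J * C_J' * (1 + 20 / δ ^ 2) *
          ((((ℓ₀ + N : ℕ) : ℝ) * ∑ s, p s) * Real.exp (δ * R₀ / 2) *
            (Real.exp (δ / 2) * (1 + 480 * Real.exp (δ / 4) * (4 / δ) ^ 4))) ^ 2 := by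
  have h := coarse_mix2_secondMoment_le
    (qd := fun u b c => ker₁ (blkW N p) (blkFld N μ u) (blkBg N μ u rad id) b c) (R := R₀ + 2)
    hδ hN hU hW hI S V v₀ hJ hJ' (fun c => windowedMass_blk_le hδ hN μ hp hrad hR₀ hradR U W S c)
  have e : (((R₀ + 2 : ℕ) : ℝ)) = (R₀ : ℝ) + 2 := by push_cast; ring
  rw [e] at h
  exact h

/-! ## §3 Free windows: the far terms vanish -/

/-- [folklore] **FAR TERMS VANISH**: if the jet kernel `q u b c` vanishes unless `PU b u` (coarse locality) and `q u b (b + w)` vanishes unless `PW w`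
(field-leg locality), then the (MIX-2) loop kernel summed over ARBITRARY finite coarse and offset windows `Y`, `W` equals the one summed over the
filtered windows `Y.filter (PU b)`, `Y.filter (PU b′)`, `W.filter PW` (`Finset.sum_filter_of_ne`). -/
theorem loopKernel_eq_filter {q : Pt → Pt → Pt → ℝ} (I : Pt → Pt → ℝ) (PU : Pt → Pt → Prop) [∀ b, DecidablePred (PU b)]
    (PW : Pt → Prop) [DecidablePred PW]
    (hzU : ∀ u b c, ¬ PU b u → q u b c = 0) (hzW : ∀ u b w, ¬ PW w → q u b (b + w) = 0) (Y W : Finset Pt) (b b' : Pt) :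
    (∑ u ∈ Y, ∑ u' ∈ Y, (∑ w ∈ W, q u b (b + w) * I (b + w) u') * (∑ w' ∈ W, q u' b' (b' + w') * I (b' + w') u))
      = ∑ u ∈ Y.filter (PU b), ∑ u' ∈ Y.filter (PU b'),
          (∑ w ∈ W.filter PW, q u b (b + w) * I (b + w) u') * (∑ w' ∈ W.filter PW, q u' b' (b' + w') * I (b' + w') u) := by
  have hleg : ∀ u u' b, ∑ w ∈ W, q u b (b + w) * I (b + w) u' = ∑ w ∈ W.filter PW, q u b (b + w) * I (b + w) u' := by
    intro u u' b
    rw [Finset.sum_filter_of_ne]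
    intro w _ hne
    by_contra hfar
    exact hne (by rw [hzW u b w hfar, zero_mul])
  have hleg0 : ∀ u u' b, ¬ PU b u → ∑ w ∈ W, q u b (b + w) * I (b + w) u' = 0 := fun u u' b hfar =>
    Finset.sum_eq_zero fun w _ => by rw [hzU u b (b + w) hfar, zero_mul]
  symm
  rw [Finset.sum_filter_of_ne]
  · refine Finset.sum_congr rfl fun u _ => ?_
    rw [Finset.sum_filter_of_ne]
    · exact Finset.sum_congr rfl fun u' _ => by rw [← hleg u u' b, ← hleg u' u b']
    · intro u' _ hne
      by_contra hfar
      exact hne (by rw [← hleg u' u b', hleg0 u' u b' hfar, mul_zero])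
  · intro u _ hne
    by_contra hfar
    exact hne (Finset.sum_eq_zero fun u' _ => by rw [← hleg u u' b, hleg0 u u' b hfar, zero_mul])

/-- **THE (MIX-2) ENGINE AT THE ROOTED BLOCK FAMILY, FREE WINDOWS** ([folklore]): the bound of `coarse_mix2_secondMoment_blk` for the loop kernel summed
over ARBITRARY finite coarse and offset windows `Y`, `W` — NO radius hypothesis on them: a far coarse site contributes a vanishing jet row
(`blk_ker₁_ins_local`), a far offset a vanishing entry (`blk_ker₁_fld_local`), so the kernel IS the one over the filtered windows (`loopKernel_eq_filter`),
to which `coarse_mix2_secondMoment_blk` applies with radius multiplier `R₀ + 2`.  (`W ⊇ box 4 ((R₀+2)·N)` makes the offset sum the full field-leg sum.) -/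
theorem coarse_mix2_secondMoment_blk_free {δ : ℝ} (hδ : 0 < δ) (hN : 1 ≤ N) (μ : Fin 4) (hp : ∀ s, 0 ≤ p s)
    (hrad : ∀ s u x', (rad s u x').length ≤ ℓ₀) (hR₀ : 2 ≤ R₀)
    (hradR : ∀ (s : σ) (u : Pt) (q : ↥(idx N)) (ℓ : Pt), ℓ ∈ rad s u q.1.1 → supNorm (ℓ - (N : ℤ) • u) ≤ R₀ * N)
    (Y W : Finset Pt) {I J : Pt → Pt → ℝ} {C_I C_J C_J' : ℝ}
    (hI : ∀ c u, |I c u| ≤ C_I * Real.exp (-(δ / N) * (supNorm (c - (N : ℤ) • u) : ℝ)))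
    (S V : Finset Pt) (v₀ : Pt)
    (hJ : ∀ b, |J b v₀| ≤ C_J * Real.exp (-(δ / N) * (supNorm (b - (N : ℤ) • v₀) : ℝ)))
    (hJ' : ∀ b', ∑ v ∈ V, (1 + ((supNorm (b' - (N : ℤ) • v) : ℝ) / N) ^ 2) * |J b' v| ≤ C_J') :
    ∑ v ∈ V, (supNorm (v - v₀) : ℝ) ^ 2 *
        |∑ b ∈ S, ∑ b' ∈ S, J b v₀ * J b' v *
          (∑ u ∈ Y, ∑ u' ∈ Y,
            (∑ w ∈ W, ker₁ (blkW N p) (blkFld N μ u) (blkBg N μ u rad id) b (b + w) * I (b + w) u') *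
            (∑ w' ∈ W, ker₁ (blkW N p) (blkFld N μ u') (blkBg N μ u' rad id) b' (b' + w') * I (b' + w') u))|
      ≤ 3 * (C_I * Real.exp (2 * ((R₀ : ℝ) + 2) * δ)) ^ 2 * C_J * C_J' * (1 + 20 / δ ^ 2) *
          ((((ℓ₀ + N : ℕ) : ℝ) * ∑ s, p s) * Real.exp (δ * R₀ / 2) *
            (Real.exp (δ / 2) * (1 + 480 * Real.exp (δ / 4) * (4 / δ) ^ 4))) ^ 2 := by
  classical
  have hzU : ∀ u b c, ¬ supNorm (b - (N : ℤ) • u) ≤ R₀ * N →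
      ker₁ (blkW N p) (blkFld N μ u) (blkBg N μ u rad id) b c = 0 := by
    intro u b c hfar
    by_contra hne
    exact hfar (blk_ker₁_ins_local hR₀ hradR hne)
  have hzW : ∀ u b w, ¬ supNorm w ≤ (R₀ + 2) * N →
      ker₁ (blkW N p) (blkFld N μ u) (blkBg N μ u rad id) b (b + w) = 0 := by
    intro u b w hfar
    by_contra hne
    have h := blk_ker₁_fld_local hR₀ hradR hne
    rw [add_sub_cancel_left] at h
    exact hfar h
  have hUr : ∀ b, ∀ u ∈ Y.filter (fun u => supNorm (b - (N : ℤ) • u) ≤ R₀ * N), supNorm (b - (N : ℤ) • u) ≤ (R₀ + 2) * N := by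
    intro b u hu
    calc supNorm (b - (N : ℤ) • u) ≤ R₀ * N := (Finset.mem_filter.mp hu).2
      _ ≤ (R₀ + 2) * N := Nat.mul_le_mul_right N (Nat.le_add_right R₀ 2)
  have hWr : ∀ w ∈ W.filter (fun w => supNorm w ≤ (R₀ + 2) * N), supNorm w ≤ (R₀ + 2) * N :=
    fun w hw => (Finset.mem_filter.mp hw).2
  have hA := coarse_mix2_secondMoment_blk hδ hN μ hp hrad hR₀ hradR hUr hWr hI S V v₀ hJ hJ'
  have hker := fun b b' => loopKernel_eq_filter (q := fun u b c => ker₁ (blkW N p) (blkFld N μ u) (blkBg N μ u rad id) b c) I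
    (fun b u => supNorm (b - (N : ℤ) • u) ≤ R₀ * N) (fun w => supNorm w ≤ (R₀ + 2) * N) hzU hzW Y W b b'
  simp only [hker]
  exact hA

end Block

/-! ## §4 The perfect lattice columns and the END -/

section Columns

variable {Lc : ℕ} [NeZero Lc]

/-- [our object] **THE LATTICE COLUMNS `J_m := N⁴ • colOf (KPerf Lc (sfStep Lc) (smStep 3 Lc) m)` IN THE ENGINE's LETTER SHAPES (I)∕(J) AND (J′)**
(`PerfectColumnEngineLetters.engineLetters_perfCol` times `N⁴`, `N = Lc^m`; `d = 3`, `2 ≤ Lc`): ONE `κ₀ > 0`, `C ≥ 0` such that for ALL `m ≥ 1` and all `κ l`: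
(I)∕(J) `|J_m κ l (N•u − c)| ≤ C·N⁻¹·e^{−((κ₀∕4)∕N)‖c − N•u‖∞}`; (J′) `Σ_{v∈V}(1 + (‖b − N•v‖∞∕N)²)|J_m κ l (N•v − b)| ≤ C·N⁻¹·A(κ₀)`,
`A(κ₀) = (1 + 16∕(κ₀∕4)²)·(e^{κ₀∕8}·(1 + 480·e^{κ₀∕16}·(2∕(κ₀∕8))⁴))`, every finite `V`. -/
theorem latticeColumn_engineLetters (hLc : 2 ≤ Lc) :
    ∃ κ₀ C : ℝ, 0 < κ₀ ∧ 0 ≤ C ∧ ∀ m : ℕ, 1 ≤ m → ∀ κ l : Fin 4,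
      (∀ c u : Pt,
        |((((Lc ^ m : ℕ) : ℝ) ^ 4) • colOf (KPerf (d := 3) Lc (sfStep Lc) (smStep 3 Lc) m)) κ l (((Lc ^ m : ℕ) : ℤ) • u - c)|
          ≤ C * (((Lc ^ m : ℕ) : ℝ))⁻¹
              * Real.exp (-(κ₀ / 4 / ((Lc ^ m : ℕ) : ℝ)) * (supNorm (c - ((Lc ^ m : ℕ) : ℤ) • u) : ℝ))) ∧
      (∀ (b : Pt) (V : Finset Pt),
        ∑ v ∈ V, (1 + ((supNorm (b - ((Lc ^ m : ℕ) : ℤ) • v) : ℝ) / ((Lc ^ m : ℕ) : ℝ)) ^ 2)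
            * |((((Lc ^ m : ℕ) : ℝ) ^ 4) • colOf (KPerf (d := 3) Lc (sfStep Lc) (smStep 3 Lc) m)) κ l (((Lc ^ m : ℕ) : ℤ) • v - b)|
          ≤ C * (((Lc ^ m : ℕ) : ℝ))⁻¹ * ((1 + 16 / (κ₀ / 4) ^ 2)
              * (Real.exp (κ₀ / 4 / 2) * (1 + 480 * Real.exp (κ₀ / 4 / 2 / 2) * (2 / (κ₀ / 4 / 2)) ^ 4)))) := by
  obtain ⟨κ₀, C, C', hκ₀, hC, _, h⟩ := engineLetters_perfCol (Lc := Lc) hLc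
  refine ⟨κ₀, C, hκ₀, hC, fun m hm κ l => ?_⟩
  obtain ⟨hJ, _, hJ'⟩ := h m hm
  have hN : (0 : ℝ) < ((Lc ^ m : ℕ) : ℝ) := by
    have : 0 < Lc := lt_of_lt_of_le (by norm_num) hLc
    exact_mod_cast pow_pos this m
  have habs : ∀ x : Pt, |((((Lc ^ m : ℕ) : ℝ) ^ 4) • colOf (KPerf (d := 3) Lc (sfStep Lc) (smStep 3 Lc) m)) κ l x|
      = ((Lc ^ m : ℕ) : ℝ) ^ 4 * |colOf (KPerf (d := 3) Lc (sfStep Lc) (smStep 3 Lc) m) κ l x| := by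
    intro x
    simp only [Pi.smul_apply, smul_eq_mul, abs_mul]
    rw [abs_of_nonneg (by positivity : (0 : ℝ) ≤ ((Lc ^ m : ℕ) : ℝ) ^ 4)]
  refine ⟨fun c u => ?_, fun b V => ?_⟩
  · rw [habs]
    calc ((Lc ^ m : ℕ) : ℝ) ^ 4 * |colOf (KPerf (d := 3) Lc (sfStep Lc) (smStep 3 Lc) m) κ l (((Lc ^ m : ℕ) : ℤ) • u - c)|
        ≤ ((Lc ^ m : ℕ) : ℝ) ^ 4 * (C * (((Lc ^ m : ℕ) : ℝ) ^ 5)⁻¹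
            * Real.exp (-(κ₀ / 4 / ((Lc ^ m : ℕ) : ℝ)) * (supNorm (c - ((Lc ^ m : ℕ) : ℤ) • u) : ℝ))) :=
          mul_le_mul_of_nonneg_left (hJ κ l c u) (by positivity)
      _ = C * (((Lc ^ m : ℕ) : ℝ))⁻¹
            * Real.exp (-(κ₀ / 4 / ((Lc ^ m : ℕ) : ℝ)) * (supNorm (c - ((Lc ^ m : ℕ) : ℤ) • u) : ℝ)) := by
          field_simp
  · simp only [habs]
    calc ∑ v ∈ V, (1 + ((supNorm (b - ((Lc ^ m : ℕ) : ℤ) • v) : ℝ) / ((Lc ^ m : ℕ) : ℝ)) ^ 2)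
            * (((Lc ^ m : ℕ) : ℝ) ^ 4 * |colOf (KPerf (d := 3) Lc (sfStep Lc) (smStep 3 Lc) m) κ l (((Lc ^ m : ℕ) : ℤ) • v - b)|)
        = ((Lc ^ m : ℕ) : ℝ) ^ 4 * ∑ v ∈ V, (1 + ((supNorm (b - ((Lc ^ m : ℕ) : ℤ) • v) : ℝ) / ((Lc ^ m : ℕ) : ℝ)) ^ 2)
            * |colOf (KPerf (d := 3) Lc (sfStep Lc) (smStep 3 Lc) m) κ l (((Lc ^ m : ℕ) : ℤ) • v - b)| := by
          rw [Finset.mul_sum]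
          exact Finset.sum_congr rfl fun v _ => by ring
      _ ≤ ((Lc ^ m : ℕ) : ℝ) ^ 4 * (C * (((Lc ^ m : ℕ) : ℝ) ^ 5)⁻¹ * ((1 + 16 / (κ₀ / 4) ^ 2)
            * (Real.exp (κ₀ / 4 / 2) * (1 + 480 * Real.exp (κ₀ / 4 / 2 / 2) * (2 / (κ₀ / 4 / 2)) ^ 4)))) :=
          mul_le_mul_of_nonneg_left (hJ' κ l b V) (by positivity)
      _ = C * (((Lc ^ m : ℕ) : ℝ))⁻¹ * ((1 + 16 / (κ₀ / 4) ^ 2)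
            * (Real.exp (κ₀ / 4 / 2) * (1 + 480 * Real.exp (κ₀ / 4 / 2 / 2) * (2 / (κ₀ / 4 / 2)) ^ 4))) := by
          field_simp

/-- **THE END `mix2_rem_blockFamily` — ROW RHOA-6e (INST-MIX), THE OWNER's DISPLAY VERBATIM** ([our object]; `d = 3`, `2 ≤ Lc`): there are `κ₀ > 0`
and `C ≥ 0` (the perfect columns' letters, `latticeColumn_engineLetters`) such that for EVERY `m ≥ 1`, with `N = Lc^m` and
`J_m = N⁴ • colOf (KPerf Lc (sfStep Lc) (smStep 3 Lc) m)`, for every coarse direction `μ`, leg index pairs `(κI,lI)`, `(κJ,lJ)`, every rooted block family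
at blocking `N` (rules `σ` with probabilities `p σ ≥ 0`, radial words `rad σ u x′` of length `≤ ℓ₀` within `R₀·N` of the anchor, `2 ≤ R₀`; point labels), all
finite windows `Y` (coarse), `W` (field-leg offsets), `S` (insertions), `V` (running coarse sites) and every `v₀`:
`Σ_{v∈V}‖v−v₀‖∞²·|Σ_{b,b′∈S} J_m κJ lJ (N•v₀−b)·J_m κJ lJ (N•v−b′)·Σ_{u,u′∈Y}(Σ_{w∈W} ker₁^{(u)} b (b+w)·J_m κI lI (N•u′−(b+w)))·(Σ_{w′∈W} ker₁^{(u′)} b′ (b′+w′)·J_m κI lI (N•u−(b′+w′)))|`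
`≤ 3·(C·N⁻¹·e^{2(R₀+2)(κ₀∕4)})²·(C·N⁻¹)·(C·N⁻¹·A(κ₀))·(1+20∕(κ₀∕4)²)·(((ℓ₀+N)·Σ_σ p σ)·e^{(κ₀∕4)R₀∕2}·(e^{(κ₀∕4)∕2}(1+480e^{(κ₀∕4)∕4}(4∕(κ₀∕4))⁴)))²`
— EVERY power of `N` displayed: `N⁻⁴·((ℓ₀+N)·Σp)²` times `m`-free numbers, n-free iff `(ℓ₀+N)·Σ_σ p σ ≲ N²` (KER-γ (γ)'s instance number; `ℓ₀ ≤ (2d+2)N`).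
`∃ κ₀ C` stands BEFORE `∀ m` and before the block-family data (which may depend on `m`).  NOT the identification with the road's (MIX-2) term, NOT the
four-direction sum, NOT `Mix_n = O(1)`, NOT hbook, NOT D1, NOT BetaPertH. -/
theorem mix2_rem_blockFamily (hLc : 2 ≤ Lc) :
    ∃ κ₀ C : ℝ, 0 < κ₀ ∧ 0 ≤ C ∧ ∀ m : ℕ, 1 ≤ m →
      ∀ {σ : Type*} [Fintype σ] (μ κI lI κJ lJ : Fin 4) {p : σ → ℝ} (_ : ∀ s, 0 ≤ p s)
        {rad : σ → Pt → Pt → List Pt} {ℓ₀ R₀ : ℕ} (_ : ∀ s u x', (rad s u x').length ≤ ℓ₀) (_ : 2 ≤ R₀)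
        (_ : ∀ (s : σ) (u : Pt) (q : ↥(idx (Lc ^ m))) (ℓ : Pt), ℓ ∈ rad s u q.1.1 →
          supNorm (ℓ - ((Lc ^ m : ℕ) : ℤ) • u) ≤ R₀ * Lc ^ m)
        (Y W S V : Finset Pt) (v₀ : Pt),
        ∑ v ∈ V, (supNorm (v - v₀) : ℝ) ^ 2 *
            |∑ b ∈ S, ∑ b' ∈ S,
              ((((Lc ^ m : ℕ) : ℝ) ^ 4) • colOf (KPerf (d := 3) Lc (sfStep Lc) (smStep 3 Lc) m)) κJ lJ (((Lc ^ m : ℕ) : ℤ) • v₀ - b) *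
              ((((Lc ^ m : ℕ) : ℝ) ^ 4) • colOf (KPerf (d := 3) Lc (sfStep Lc) (smStep 3 Lc) m)) κJ lJ (((Lc ^ m : ℕ) : ℤ) • v - b') *
              (∑ u ∈ Y, ∑ u' ∈ Y,
                (∑ w ∈ W, ker₁ (blkW (Lc ^ m) p) (blkFld (Lc ^ m) μ u) (blkBg (Lc ^ m) μ u rad id) b (b + w) *
                  ((((Lc ^ m : ℕ) : ℝ) ^ 4) • colOf (KPerf (d := 3) Lc (sfStep Lc) (smStep 3 Lc) m)) κI lI
                    (((Lc ^ m : ℕ) : ℤ) • u' - (b + w))) *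
                (∑ w' ∈ W, ker₁ (blkW (Lc ^ m) p) (blkFld (Lc ^ m) μ u') (blkBg (Lc ^ m) μ u' rad id) b' (b' + w') *
                  ((((Lc ^ m : ℕ) : ℝ) ^ 4) • colOf (KPerf (d := 3) Lc (sfStep Lc) (smStep 3 Lc) m)) κI lI
                    (((Lc ^ m : ℕ) : ℤ) • u - (b' + w'))))|
          ≤ 3 * (C * (((Lc ^ m : ℕ) : ℝ))⁻¹ * Real.exp (2 * ((R₀ : ℝ) + 2) * (κ₀ / 4))) ^ 2
              * (C * (((Lc ^ m : ℕ) : ℝ))⁻¹)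
              * (C * (((Lc ^ m : ℕ) : ℝ))⁻¹ * ((1 + 16 / (κ₀ / 4) ^ 2)
                  * (Real.exp (κ₀ / 4 / 2) * (1 + 480 * Real.exp (κ₀ / 4 / 2 / 2) * (2 / (κ₀ / 4 / 2)) ^ 4))))
              * (1 + 20 / (κ₀ / 4) ^ 2)
              * ((((ℓ₀ + Lc ^ m : ℕ) : ℝ) * ∑ s, p s) * Real.exp ((κ₀ / 4) * R₀ / 2) *
                  (Real.exp ((κ₀ / 4) / 2) * (1 + 480 * Real.exp ((κ₀ / 4) / 4) * (4 / (κ₀ / 4)) ^ 4))) ^ 2 := by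
  obtain ⟨κ₀, C, hκ₀, hC, h⟩ := latticeColumn_engineLetters (Lc := Lc) hLc
  refine ⟨κ₀, C, hκ₀, hC, fun m hm σ _ μ κI lI κJ lJ p hp rad ℓ₀ R₀ hrad hR₀ hradR Y W S V v₀ => ?_⟩
  have hN1 : 1 ≤ Lc ^ m := Nat.one_le_pow m Lc (le_trans (by norm_num) hLc)
  have hδ : 0 < κ₀ / 4 := by positivity
  exact coarse_mix2_secondMoment_blk_free (N := Lc ^ m) hδ hN1 μ hp hrad hR₀ hradR Y W
    (I := fun c u => ((((Lc ^ m : ℕ) : ℝ) ^ 4) • colOf (KPerf (d := 3) Lc (sfStep Lc) (smStep 3 Lc) m)) κI lI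
      (((Lc ^ m : ℕ) : ℤ) • u - c))
    (J := fun b v => ((((Lc ^ m : ℕ) : ℝ) ^ 4) • colOf (KPerf (d := 3) Lc (sfStep Lc) (smStep 3 Lc) m)) κJ lJ
      (((Lc ^ m : ℕ) : ℤ) • v - b))
    (fun c u => (h m hm κI lI).1 c u) S V v₀ (fun b => (h m hm κJ lJ).1 b v₀) (fun b' => (h m hm κJ lJ).2 b' V)

end Columns

end Summit.QuantumFields.BalabanUV.Beta.FP.MixLoopInstanceBlockFamily

end
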